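import Summits.BirchSwinnertonDyer.BirchSwinnertonDyer.Theorems.PrintX10bBeyondCarrierUpperLinkCoprimePinned
import Summits.BirchSwinnertonDyer.BirchSwinnertonDyer.Theorems.PrintX9HowardContainmentLightFrameOfPrintDepthPosLocalized
import Literature.NumberTheory.EllipticCurves.IwasawaAlgebraPromotionProofs
import HarnessLib

/-!
# Crux `BeyondCarrierDepthX10b` (stmt-BirchSwinnertonDyer-23055), line «twins», skeleton v6 (μ-split of the
# one-sided link U₃ on the `3 ∣ h_K` frames): kernel witnesses of the stubs s2b and s2d modulo named facts,
# and the reduction of the research stub s2c to `μ(X_tors) = 0`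

HONEST FRAMING (cell `run/shared/lean/pub/bsd-print-x9/`, LEAD seat bsd-line-x10b-p1 g2 of the registered line on
crux 23055, D-0154 KEY row 10): THEOREMS ONLY, helpers `--supports 23055`; nothing booked, nothing closed. The
three theorems prove, BY SIGNATURE (the letter of the v6 stubs registered on 23055), two of the four stages of the
pinned Howard road for U₃ on the `3 ∣ h_K` X10b frames modulo cite-only facts, and reduce the third (the μ-part,
the research kernel of the crux) to ONE clean statement. «beyond-print theorem»: NO. BSD is not proved by any
of this; no summit statement is proved by this seat.

WHAT.
* `stub_localizedStabilized_divisibleClassNumber_of_cgls (hCGLS)` — v6 stub s2b VERBATIM modulo the cite-only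
  fact `CastellaGrossiLeeSkinner2022.thm413_rankOne_charIdeal_torsion_dvd_localized` (= route binder
  `PrintX9.CGLSHowardDivisibilityLocalized`): on a rank-one `3 ∣ h_K` X10b Heegner frame (`Ш[3^∞]` finite), for
  EVERY `(D, C, X)` — `Λ`-adic Selmer datum, CGLS `d(k)`-shifted stabilized Heegner datum for the given `jbar`,
  Selmer dual — `X.X` is finitely generated and `(p^m)·I(Λκ_∞(C))² ⊆ char_Λ(X_tors)` for some `m` (CGLS 2022
  Thm. 4.1.3 "Moreover" clause = Cor. 3.4.2 at Selmer corank one). Hypotheses of Thm. 4.1.3 in the kernel by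
  x10b-p2's `X10.thm413Hypotheses_of_classX10` (p-landed 05:39Z); corank one by x9-p2's
  `X9.selmerCorank_eq_one_of_rank_one`. The class-number binder is idle (the theorem holds at every h_K).
* `stub_upperLink_of_pinnedContainment_of_pinnedPrintFacts (h57 h59gp h422 h513 hC h331)` — v6 stub s2d VERBATIM
  modulo the six pinned class-number-free print facts: the PINNED containment `∃ jbar D F X, F.Dt = Dt ∧ I(ℋ_F)²
  ⊆ char_Λ(X_tors)` on a U₃ frame gives the two-sided link (x10b-p3 p608225
  `CompositeTransferX10b.imcWaldspurgerOnTreeGoodAt_inducedPlace_of_printFacts_of_pinnedTransfer`), hence U₃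
  (x10b-p1-w2 `UpperHalf.upperLink_of_imcWaldspurgerOnTreeGoodAt`). ANY class number.
* `stub_muPart_divisibleClassNumber_of_muInvariant_eq_zero (hμ)` — v6 stub s2c VERBATIM from the ONE statement
  `hμ`: on every rank-one `3 ∣ h_K` X10b Heegner frame, every finitely generated Selmer dual `X.X` has local
  length `0` at the height-one prime `(p)` of `Λ` (its μ-invariant vanishes). Proof: the promotion lemma
  `IwasawaAlgebra.le_charIdeal_of_span_p_pow_mul_le` (lead g0, p607965) applied to `A := I(ℋ_F)²`. `hμ` is NOT
  in print (Howard 2004 Thm. B / Mastella–Zerman 2026 Cor. 4.6 control μ only under `p ∤ h_K`; CGLS 2022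
  Cor. 3.4.2 inverts `p`; BCK 2021 Thm. 3.1 has `p > 3`) — it is the cell's named residual «μ-part of Howard's
  divisibility at `p = 3`, `3 ∣ h_K`, (irr) ¬Surj» in the kernel's letter.

References: [CastellaGrossiLeeSkinner2022] Thm. 4.1.3, Cor. 3.4.2, Rem. 4.1.4; [YanZhu2024MainConjNonCM] Thm. 5.7 (1),
Thm. 5.9; [BurungaleCastellaSkinner2025] Prop. 4.2.2; [JetchevSkinnerWan2017] Thm. 3.3.1; [Castella2018] §5;
[Washington1997] §13.2; [Howard2004HeegnerKolyvagin] Thm. B; [MastellaZerman2026] Ass. 2.1, Cor. 4.6;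
skeleton v6 `Cruxes/BeyondCarrierDepthX10b/Lines/twins.lean`.
-/

-- the REGISTERED stub namespace `Summit.BirchSwinnertonDyer.BirchSwinnertonDyer.Cruxes.…` repeats the summit name
set_option linter.dupNamespace false
set_option autoImplicit false

noncomputable section

open scoped Classical

open WeierstrassCurve NumberField IsDedekindDomain Field Literature.NumberTheory.EllipticCurves
  Literature.NumberTheory.EllipticCurves.ModularForms Literature.NumberTheory.EllipticCurves.Rank1Residual
  Literature.NumberTheory.EllipticCurves.Castella2018 Literature.NumberTheory.EllipticCurves.YanZhu2026
  Literature.NumberTheory.EllipticCurves.CastellaGrossiLeeSkinner2022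
  Literature.NumberTheory.EllipticCurves.JetchevSkinnerWan2017

open Summit.BirchSwinnertonDyer.Rank1Residual
open Summit.BirchSwinnertonDyer.BirchSwinnertonDyer.Rank1Residual (X10.thm413Hypotheses_of_classX10)
open Summit.BirchSwinnertonDyer.BirchSwinnertonDyer.Cruxes.TwoSidedLinkAnyClassNumberX10b.CompositeTransferX10b
  (imcWaldspurgerOnTreeGoodAt_inducedPlace_of_printFacts_of_pinnedTransfer)
open Summit.BirchSwinnertonDyer.BirchSwinnertonDyer.Cruxes.BeyondCarrierDepthX10b.UpperHalf
  (upperLink_of_imcWaldspurgerOnTreeGoodAt)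

namespace Summit.BirchSwinnertonDyer.BirchSwinnertonDyer.Cruxes.BeyondCarrierDepthX10b.HowardFrames

/-- **v6 stub s2b BY SIGNATURE modulo the cite-only fact `hCGLS` (CGLS 2022 Thm. 4.1.3 localized, any class
number):** on a rank-one `3 ∣ h_K` X10b Heegner frame with `Ш[3^∞]` finite, for every `Λ`-adic Selmer datum
`D`, every `d(k)`-shifted stabilized Heegner datum `C` (given `jbar`) and every Selmer dual `X`, the dual is
finitely generated over `Λ` and `(p^m)·I(Λκ_∞(C))² ⊆ char_Λ(X_tors)` for some `m`. Hypotheses of the fact by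
`X10.thm413Hypotheses_of_classX10`, Selmer corank one by `X9.selmerCorank_eq_one_of_rank_one`.
[cite: CastellaGrossiLeeSkinner2022, Thm. 4.1.3 with Cor. 3.4.2 and Rem. 4.1.4 (arXiv:2008.02571)]
[cite: GreenbergLNM1716, §1] -/
theorem stub_localizedStabilized_divisibleClassNumber_of_cgls
    (hCGLS : thm413_rankOne_charIdeal_torsion_dvd_localized.{0}) :
    ∀ (W : WeierstrassCurve ℚ) [W.IsElliptic] [W.IsGloballyMinimal] (p : ℕ) [Fact p.Prime]
    [NeZero (W.conductorNorm ℤ)] (K : Type) [Field K] [NumberField K],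
    Literature.NumberTheory.EllipticCurves.Rank1Residual.ClassX10 W p →
    ¬ Literature.NumberTheory.EllipticCurves.Rank1Residual.Surj W 3 → ¬ W.HasCM →
    Literature.NumberTheory.EllipticCurves.IsImaginaryQuadratic K → Odd (NumberField.discr K) →
    NumberField.discr K ≠ -3 →
    Literature.NumberTheory.EllipticCurves.SatisfiesHeegnerHypothesis (W.conductorNorm ℤ) K →
    Literature.NumberTheory.EllipticCurves.SatisfiesHeegnerHypothesis p K →
    p ∣ NumberField.classNumber K →
    (W.baseChange K).HasIrreducibleModPGaloisRep p →
    ∀ (κ : Literature.NumberTheory.EllipticCurves.ZpExtension K p), κ.IsAnticyclotomic →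
    ∀ (γ : Field.absoluteGaloisGroup K), κ.IsTopGenerator γ →
    ∀ (jbar : AlgebraicClosure K →+* ℂ),
    (W.baseChange K).mordellWeilRank = 1 →
    Finite (AddCommGroup.primaryComponent (W.baseChange K).sha p) →
    ∀ (D : (W.baseChange K).LambdaAdicSelmerData κ γ)
      (C : Literature.NumberTheory.EllipticCurves.CastellaGrossiLeeSkinner2022.StabilizedHeegnerData
        (W.conductorNorm ℤ) W K κ jbar)
      (X : (W.baseChange K).SelmerDualData κ γ),
    Module.Finite (Literature.NumberTheory.EllipticCurves.IwasawaAlgebra p) X.X ∧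
    ∃ m : ℕ, Ideal.span {((p : Literature.NumberTheory.EllipticCurves.IwasawaAlgebra p) ^ m)} *
          Literature.NumberTheory.EllipticCurves.CastellaGrossiLeeSkinner2022.stabilizedHeegnerCharIdeal D C ^ 2 ≤
        Literature.NumberTheory.EllipticCurves.Module.charIdeal
          (Literature.NumberTheory.EllipticCurves.IwasawaAlgebra p)
          (Submodule.torsion (Literature.NumberTheory.EllipticCurves.IwasawaAlgebra p) X.X) := by
  intro W _ _ p _ _ K _ _ hX _ _ hK hodd h3 hHN hHp _ _ κ hκ γ hγ jbar hrk hfin D C X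
  have hyp := X10.thm413Hypotheses_of_classX10 hX hK h3 hHN hHp hodd hκ hγ
  obtain ⟨-, hfinX, -⟩ := hCGLS (W.conductorNorm ℤ) W K p κ γ jbar hyp D C X
  obtain ⟨m, hm⟩ := span_pow_mul_sq_le_charIdeal_torsion_of_thm413 hCGLS hyp
    (X9.selmerCorank_eq_one_of_rank_one hrk hfin) D C X
  exact ⟨hfinX, m, hm⟩

/-- **v6 stub s2d BY SIGNATURE modulo the six pinned class-number-free print facts:** on a U₃ frame (X10b
pair, `K` imaginary quadratic with odd `d_K ≠ −3`, Heegner for `N_E` and `p`, (irr_K), anticyclotomic datum,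
Manin-good `Dt`, `P` the Heegner point of `(Dt, H)`, rank one, `Ш[p^∞]` finite, `P` non-torsion) the PINNED
containment `∃ jbar D F X, F.Dt = Dt ∧ I(ℋ_F)² ⊆ char_Λ(X_tors)` gives the two-sided link at the induced place
(x10b-p3's `imcWaldspurgerOnTreeGoodAt_inducedPlace_of_printFacts_of_pinnedTransfer`), hence its `≤` half U₃
(`upperLink_of_imcWaldspurgerOnTreeGoodAt`). ANY class number. Facts: `h57` (Yan–Zhu Thm. 5.7 (1)), `h59gp`
(Yan–Zhu Thm. 5.9 pinned, class-number-free, direction (2)⟹(1) at `s = 1`, in the letter of p608225; served by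
the Literature fact `YanZhu2026.thm59_localised_pinned_anyClassNumber`, lit g25 p610320), `h422` (BCS Prop.
4.2.2), `h513` (CGLS Thm. 5.1.3), `hC` (Carayol), `h331` (JSW Thm. 3.3.1).
[cite: YanZhu2024MainConjNonCM, Thm. 5.7 (1) and Thm. 5.9] [cite: BurungaleCastellaSkinner2025, Prop. 4.2.2]
[cite: CastellaGrossiLeeSkinner2022, Thm. 5.1.3] [cite: JetchevSkinnerWan2017, Thm. 3.3.1]
[cite: Castella2018, §5 (eq:IMC+BDP)] -/
theorem stub_upperLink_of_pinnedContainment_of_pinnedPrintFacts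
    (h57 : thm57_isTorsion_charIdealXGr_eq_bdpLFunction)
    (h59gp : ∀ {p : ℕ} [Fact p.Prime] (ι' : PadicAlgCl p ≃+* ℂ) (W : WeierstrassCurve ℚ) [W.IsElliptic]
      [W.IsGloballyMinimal] (K : Type) [Field K] [NumberField K] (v vbar : HeightOneSpectrum (𝓞 K))
      (κ : ZpExtension K p) (γ : absoluteGaloisGroup K) [Fact (κ.IsTopGenerator γ)] {N : ℕ} [NeZero N]
      {f : CuspForm (CongruenceSubgroup.Gamma0 N) 2} (jbar : AlgebraicClosure K →+* ℂ)
      (_ : IsNewformOf W f),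
      N = W.conductorNorm ℤ → 3 ≤ p → GoodOrd W p → (W.baseChange K).HasIrreducibleModPGaloisRep p →
      IsImaginaryQuadratic K → SatisfiesHeegnerHypothesis N K →
        ((Ideal.span {(p : ℤ)}).primesOver (𝓞 K)).ncard = 2 →
        Odd (NumberField.discr K) → NumberField.discr K ≠ -3 → κ.IsAnticyclotomic →
      (∀ (w : InfinitePlace K) (k : 𝓞 K), k ∈ v.asIdeal ↔ ‖ι'.symm (w.embedding (k : K))‖ < 1) →
        ((p : ℕ) : 𝓞 K) ∈ vbar.asIdeal → vbar ≠ v →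
      ∃ (ΩK : ℂ) (Ωp : (unrIntegers p)ˣ) (L : UnrSeries p),
        ΩK ≠ 0 ∧ IsBDPLFunction ι' v κ γ f ΩK ((Ωp : unrIntegers p) : ℂ_[p]) L ∧
        ∀ (D : (W.baseChange K).LambdaAdicSelmerData κ γ) (F : HeegnerFamily N W K κ jbar)
          (X : (W.baseChange K).SelmerDualData κ γ) (j : ℤ_[p] →+* unrIntegers p),
          ¬ (p : ℤ) ∣ F.Dt.c →
          (∀ x : ℤ_[p], ((j x : unrIntegers p) : ℂ_[p]) = algebraMap ℚ_[p] ℂ_[p] (x : ℚ_[p])) →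
          heegnerCharIdeal D F ^ 2 ≤
              Module.charIdeal (IwasawaAlgebra p) (Submodule.torsion (IwasawaAlgebra p) X.X) →
            L ∈ (AcSelmer.XAc.charIdeal (W.baseChange K) p κ vbar ∅ γ).map (PowerSeries.map j))
    (h422 : BurungaleCastellaSkinner2025.prop422_exists_isBDPLFunction_mu_eq_zero)
    (h513 : thm513_exists_isBDPLFunction_valueAtOne_disc)
    (hC : ∀ (N : ℕ) [NeZero N], IsNewformOf.level_eq_conductorNorm (N := N))
    (h331 : thm331_anticyclotomicControl) :
    ∀ (W : WeierstrassCurve ℚ) [W.IsElliptic] [W.IsGloballyMinimal] (p : ℕ) [Fact p.Prime]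
    [NeZero (W.conductorNorm ℤ)] (K : Type) [Field K] [NumberField K],
    Literature.NumberTheory.EllipticCurves.Rank1Residual.ClassX10 W p →
    ¬ Literature.NumberTheory.EllipticCurves.Rank1Residual.Surj W 3 → ¬ W.HasCM →
    Literature.NumberTheory.EllipticCurves.IsImaginaryQuadratic K → Odd (NumberField.discr K) →
    NumberField.discr K ≠ -3 →
    Literature.NumberTheory.EllipticCurves.SatisfiesHeegnerHypothesis (W.conductorNorm ℤ) K →
    Literature.NumberTheory.EllipticCurves.SatisfiesHeegnerHypothesis p K →
    (W.baseChange K).HasIrreducibleModPGaloisRep p →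
    ∀ (ι : K →+* ℚ_[p]) (κ : Literature.NumberTheory.EllipticCurves.ZpExtension K p), κ.IsAnticyclotomic →
    ∀ (γ : Field.absoluteGaloisGroup K) [Fact (κ.IsTopGenerator γ)]
    (Dt : Literature.NumberTheory.EllipticCurves.ModularForms.ModularParametrizationData W
    (W.conductorNorm ℤ)), ¬ (p : ℤ) ∣ Dt.c →
    ∀ (H : Literature.NumberTheory.EllipticCurves.HeegnerDatum (W.conductorNorm ℤ) (NumberField.discr K))
    (ιC : K →+* ℂ) (P : (W.baseChange K).toAffine.Point),
    WeierstrassCurve.Affine.Point.map ιC.toRatAlgHom P =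
    Literature.NumberTheory.EllipticCurves.ModularForms.heegnerPointComplex Dt H →
    (W.baseChange K).mordellWeilRank = 1 →
    Finite (AddCommGroup.primaryComponent (W.baseChange K).sha p) → ¬ IsOfFinAddOrder P →
    (∃ (jbar : AlgebraicClosure K →+* ℂ) (D : (W.baseChange K).LambdaAdicSelmerData κ γ)
        (F : Literature.NumberTheory.EllipticCurves.HeegnerFamily (W.conductorNorm ℤ) W K κ jbar)
        (X : (W.baseChange K).SelmerDualData κ γ),
        F.Dt = Dt ∧ Literature.NumberTheory.EllipticCurves.heegnerCharIdeal D F ^ 2 ≤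
          Literature.NumberTheory.EllipticCurves.Module.charIdeal
            (Literature.NumberTheory.EllipticCurves.IwasawaAlgebra p)
            (Submodule.torsion (Literature.NumberTheory.EllipticCurves.IwasawaAlgebra p) X.X)) →
    ∃ n : ℕ, Summit.BirchSwinnertonDyer.Rank1Residual.X11b.AcSelmer.XAc.HasCharValuationAt
    (W.baseChange K) p κ (Summit.BirchSwinnertonDyer.Rank1Residual.X11b.inducedPlace ι) ∅ γ n ∧
    (n : ℤ) ≤ 2 * (Summit.BirchSwinnertonDyer.Rank1Residual.X11b.padicLogOrd W p ι P +
    (padicValInt p (1 - W.frobeniusTrace p + p) : ℤ) - 1) := by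
  intro W _ _ p _ _ K _ _ hX _ _ hK hodd h3 hHN hHp hirrK ι κ hκ γ _ Dt hc H ιC P hP hrk hfinp hPinf hHow
  obtain ⟨hp3, hord, -, -⟩ := id hX
  subst hp3
  exact upperLink_of_imcWaldspurgerOnTreeGoodAt
    (imcWaldspurgerOnTreeGoodAt_inducedPlace_of_printFacts_of_pinnedTransfer h57 h59gp h422 h513 hC h331
      le_rfl hord hK hodd h3 rfl hHN hHp hirrK ι κ hκ γ Dt hc H ιC P hP hrk hfinp hPinf hHow)

/-- **v6 stub s2c (the μ-part, the research kernel of the crux) REDUCES to `μ(X_tors) = 0`** — census in the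
kernel: if on every rank-one `3 ∣ h_K` X10b Heegner frame (the s2c binders up to `(κ, γ)`, rank one, `Ш[p^∞]`
finite) every finitely generated Selmer dual `X.X` has local length `0` at the height-one prime `(p)` of
`Λ = ℤ_p⟦T⟧` (its μ-invariant vanishes), then s2c holds: `(p^m)·I(ℋ_F)² ⊆ char_Λ(X_tors)` promotes to
`I(ℋ_F)² ⊆ char_Λ(X_tors)` by `IwasawaAlgebra.le_charIdeal_of_span_p_pow_mul_le` (Washington §13.2; lead g0
p607965). The hypothesis is NOT in print on class X10b at `3 ∣ h_K`. [cite: Washington1997, §13.2]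
[cite: Howard2004HeegnerKolyvagin, Thm. B] [cite: MastellaZerman2026, Ass. 2.1 and Cor. 4.6]
[cite: CastellaGrossiLeeSkinner2022, Cor. 3.4.2] -/
theorem stub_muPart_divisibleClassNumber_of_muInvariant_eq_zero
    (hμ : ∀ (W : WeierstrassCurve ℚ) [W.IsElliptic] [W.IsGloballyMinimal] (p : ℕ) [Fact p.Prime]
      [NeZero (W.conductorNorm ℤ)] (K : Type) [Field K] [NumberField K],
      Literature.NumberTheory.EllipticCurves.Rank1Residual.ClassX10 W p →
      ¬ Literature.NumberTheory.EllipticCurves.Rank1Residual.Surj W 3 → ¬ W.HasCM →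
      Literature.NumberTheory.EllipticCurves.IsImaginaryQuadratic K → Odd (NumberField.discr K) →
      NumberField.discr K ≠ -3 →
      Literature.NumberTheory.EllipticCurves.SatisfiesHeegnerHypothesis (W.conductorNorm ℤ) K →
      Literature.NumberTheory.EllipticCurves.SatisfiesHeegnerHypothesis p K →
      p ∣ NumberField.classNumber K →
      (W.baseChange K).HasIrreducibleModPGaloisRep p →
      ∀ (κ : Literature.NumberTheory.EllipticCurves.ZpExtension K p), κ.IsAnticyclotomic →
      ∀ (γ : Field.absoluteGaloisGroup K), κ.IsTopGenerator γ →
      (W.baseChange K).mordellWeilRank = 1 →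
      Finite (AddCommGroup.primaryComponent (W.baseChange K).sha p) →
      ∀ (X : (W.baseChange K).SelmerDualData κ γ),
        Module.Finite (Literature.NumberTheory.EllipticCurves.IwasawaAlgebra p) X.X →
      ∀ 𝔭 : PrimeSpectrum (Literature.NumberTheory.EllipticCurves.IwasawaAlgebra p),
        𝔭.asIdeal = Ideal.span {(p : Literature.NumberTheory.EllipticCurves.IwasawaAlgebra p)} →
        Module.lengthAt (Literature.NumberTheory.EllipticCurves.IwasawaAlgebra p)
          (Submodule.torsion (Literature.NumberTheory.EllipticCurves.IwasawaAlgebra p) X.X) 𝔭 = 0) :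
    ∀ (W : WeierstrassCurve ℚ) [W.IsElliptic] [W.IsGloballyMinimal] (p : ℕ) [Fact p.Prime]
    [NeZero (W.conductorNorm ℤ)] (K : Type) [Field K] [NumberField K],
    Literature.NumberTheory.EllipticCurves.Rank1Residual.ClassX10 W p →
    ¬ Literature.NumberTheory.EllipticCurves.Rank1Residual.Surj W 3 → ¬ W.HasCM →
    Literature.NumberTheory.EllipticCurves.IsImaginaryQuadratic K → Odd (NumberField.discr K) →
    NumberField.discr K ≠ -3 →
    Literature.NumberTheory.EllipticCurves.SatisfiesHeegnerHypothesis (W.conductorNorm ℤ) K →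
    Literature.NumberTheory.EllipticCurves.SatisfiesHeegnerHypothesis p K →
    p ∣ NumberField.classNumber K →
    (W.baseChange K).HasIrreducibleModPGaloisRep p →
    ∀ (κ : Literature.NumberTheory.EllipticCurves.ZpExtension K p), κ.IsAnticyclotomic →
    ∀ (γ : Field.absoluteGaloisGroup K), κ.IsTopGenerator γ →
    ∀ (Dt : Literature.NumberTheory.EllipticCurves.ModularForms.ModularParametrizationData W
      (W.conductorNorm ℤ))
      (H : Literature.NumberTheory.EllipticCurves.HeegnerDatum (W.conductorNorm ℤ) (NumberField.discr K))
      (ιC : K →+* ℂ) (jbar : AlgebraicClosure K →+* ℂ),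
    ¬ (p : ℤ) ∣ Dt.c → (W.baseChange K).mordellWeilRank = 1 →
    Finite (AddCommGroup.primaryComponent (W.baseChange K).sha p) →
    (∃ (D : (W.baseChange K).LambdaAdicSelmerData κ γ)
        (F : Literature.NumberTheory.EllipticCurves.HeegnerFamily (W.conductorNorm ℤ) W K κ jbar)
        (X : (W.baseChange K).SelmerDualData κ γ) (m : ℕ),
        F.Dt = Dt ∧ Module.Finite (Literature.NumberTheory.EllipticCurves.IwasawaAlgebra p) X.X ∧
        Ideal.span {((p : Literature.NumberTheory.EllipticCurves.IwasawaAlgebra p) ^ m)} *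
            Literature.NumberTheory.EllipticCurves.heegnerCharIdeal D F ^ 2 ≤
          Literature.NumberTheory.EllipticCurves.Module.charIdeal
            (Literature.NumberTheory.EllipticCurves.IwasawaAlgebra p)
            (Submodule.torsion (Literature.NumberTheory.EllipticCurves.IwasawaAlgebra p) X.X)) →
    ∃ (D : (W.baseChange K).LambdaAdicSelmerData κ γ)
      (F : Literature.NumberTheory.EllipticCurves.HeegnerFamily (W.conductorNorm ℤ) W K κ jbar)
      (X : (W.baseChange K).SelmerDualData κ γ),
      F.Dt = Dt ∧ Literature.NumberTheory.EllipticCurves.heegnerCharIdeal D F ^ 2 ≤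
        Literature.NumberTheory.EllipticCurves.Module.charIdeal
          (Literature.NumberTheory.EllipticCurves.IwasawaAlgebra p)
          (Submodule.torsion (Literature.NumberTheory.EllipticCurves.IwasawaAlgebra p) X.X) := by
  intro W _ _ p _ _ K _ _ hX hns hcm hK hodd h3 hHN hHp hhK hirr κ hκ γ hγ Dt H ιC jbar hc hrk hfin
    ⟨D, F, X, m, hFDt, hfinX, hloc⟩
  haveI := hfinX
  haveI : IsNoetherian (IwasawaAlgebra p) X.X := isNoetherian_of_isNoetherianRing_of_finite _ _
  haveI : Module.Finite (IwasawaAlgebra p) (Submodule.torsion (IwasawaAlgebra p) X.X) := inferInstance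
  refine ⟨D, F, X, hFDt, ?_⟩
  exact IwasawaAlgebra.le_charIdeal_of_span_p_pow_mul_le
    (Submodule.torsion_isTorsion (R := IwasawaAlgebra p) (M := X.X))
    (hμ W p K hX hns hcm hK hodd h3 hHN hHp hhK hirr κ hκ γ hγ hrk hfin X hfinX) hloc

end Summit.BirchSwinnertonDyer.BirchSwinnertonDyer.Cruxes.BeyondCarrierDepthX10b.HowardFrames

end
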